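import Literature.MathematicalPhysics.QuantumFieldTheory.QCDCalibratedSpecies
import Literature.MathematicalPhysics.QuantumFieldTheory.QCDGoldstoneBound
import Summits.QuantumFields.QCD.Theorems.QuarksNoInfraredClauseThinQCDStubUvWindowLaw
import HarnessLib

/-!
# Crux `ThinQCD` (item stmt-QuantumFields-17278): the REPAIRED diagonal step — one subsequence for every positive mass
# tuple from an EVENTUAL Lipschitz modulus on a countable family (support file of line `registered`, reshape r3/r4)

The r2 reduction (`QuarksNoInfraredClauseThinQCDStubUvWindowLaw.lean`, p150252) extracted ONE strictly increasing `φ`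
serving every positive mass tuple from `IsMassEquicontinuous` — a Lipschitz-in-`m` modulus uniform in ALL steps `k` and
asked for ALL real test tuples.  Reshape r3 records why that hypothesis is unusable (coincident tuples of dimension-3
composites; `Cruxes/ThinQCD/RESHAPE-r3.md`, D1) and that the sibling item `DiagonalSpine.MassEquicontinuity` was repaired
to an EVENTUAL (`∀ᶠ k`), family-wise form.  This file proves the diagonal step from exactly that weaker input:

* `exists_strictMono_forall_pos_tendsto` — Arzelà–Ascoli over the open positive orthant in eventual-Lipschitz form: for a
  countable family `G k i m`, pointwise eventual bounds at every positive tuple and, on every compact set of positive tuples,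
  a Lipschitz-in-`m` bound holding EVENTUALLY in `k`, give ONE strictly increasing `φ` along which `k ↦ G (φ k) i m`
  converges for every label `i` and every positive tuple `m` (equicontinuity at `m` from the Lipschitz bound on a compact
  ball inside the orthant, then the landed `exists_strictMono_forall_tendsto_of_equicontinuous`).  This is the shape the
  UV law `CounterexampleMustBeHot.ChiralCalibratedConvergence` (its line's `stub_diagonalExtraction`) and
  `DiagonalSpine.MassEquicontinuity` consume.
* `hasLatticeMassGap_restrict_scheme` — the full lattice gap of `reg.scheme m 0 0` passes to every scheme of the reindexed
  regularisation (it reads only `a, β, L, m_f(k)`).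

No definition, no named fact, no `sorry`.
-/

noncomputable section

namespace Summit.QuantumFields.QCD.Cruxes.ThinQCD.Registered

open scoped Topology SchwartzMap
open Filter
open Literature.MathematicalPhysics.QuantumFieldTheory Literature.MathematicalPhysics.QuantumLattice
  Literature.MathematicalPhysics.AQFT

variable {Nf : ℕ} {reg : QCDRegularisation Nf}

/-- **The full lattice gap is a property of `(a, β, L, m_f(k))` only**: it passes from `reg.scheme m 0 0` to the reindexed
scheme `(reg.restrict φ hφ).scheme m z shift` with ANY species data. [folklore] -/
theorem hasLatticeMassGap_restrict_scheme {m : Fin Nf → ℝ} {Δ : ℝ}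
    (h : (reg.scheme m 0 0).HasLatticeMassGap Δ) (φ : ℕ → ℕ) (hφ : Tendsto φ atTop atTop)
    (z shift : QCDField Nf → ℕ → ℝ) :
    ((reg.restrict φ hφ).scheme m z shift).HasLatticeMassGap Δ := by
  intro R R' A B
  obtain ⟨C, hC⟩ := h R R' A B
  refine ⟨C, (hφ.eventually hC).mono fun k hk => ?_⟩
  intro S hS n hn
  exact hk S hS n hn

/-- **Arzelà–Ascoli over the positive orthant, eventual-Lipschitz form** (the repaired diagonal step).  Let `G k i m ∈ ℂ`
depend on a step `k`, a countable label `i` and a mass tuple `m`.  If at every positive tuple each `k ↦ G k i m` is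
eventually bounded, and on every compact set of positive tuples each `G · i ·` is Lipschitz in `m` EVENTUALLY-uniformly in
`k`, then ONE strictly increasing `φ` makes `k ↦ G (φ k) i m` converge for every `i` and every positive `m`. [folklore] -/
theorem exists_strictMono_forall_pos_tendsto : ∀ {ι : Type} [Countable ι] (G : ℕ → ι → (Fin Nf → ℝ) → ℂ), (∀ i, ∀ m : Fin Nf → ℝ, (∀ fl, 0 < m fl) → ∃ R : ℝ, ∀ᶠ k in atTop, ‖G k i m‖ ≤ R) → (∀ i, ∀ K : Set (Fin Nf → ℝ), IsCompact K → K ⊆ {m | ∀ fl, 0 < m fl} → ∃ C : ℝ, ∀ᶠ k in atTop, ∀ m ∈ K, ∀ m' ∈ K, ‖G k i m - G k i m'‖ ≤ C * ‖m - m'‖) → ∃ φ : ℕ → ℕ, StrictMono φ ∧ ∀ m : Fin Nf → ℝ, (∀ fl, 0 < m fl) → ∀ i, ∃ l : ℂ, Tendsto (fun k => G (φ k) i m) atTop (𝓝 l) := by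
  intro ι _ G hb hL
  set P : Set (Fin Nf → ℝ) := {m | ∀ fl, 0 < m fl} with hP
  let F : ℕ → ι → P → ℂ := fun k i x => G k i (x : Fin Nf → ℝ)
  have hbF : ∀ i (x : P), ∃ R : ℝ, ∀ᶠ k in atTop, ‖F k i x‖ ≤ R := fun i x => hb i x x.2
  have heqF : ∀ i (x : P), ∀ ε > (0 : ℝ), ∃ δ > (0 : ℝ), ∀ᶠ k in atTop, ∀ y : P, dist x y < δ →
      ‖F k i x - F k i y‖ < ε := by
    intro i x ε hε
    obtain ⟨r, hr, hrK⟩ : ∃ r > (0 : ℝ), Metric.closedBall (x : Fin Nf → ℝ) r ⊆ P := by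
      obtain ⟨r, hr, hsub⟩ := Metric.isOpen_iff.1 (isOpen_setOf_forall_pos (Nf := Nf)) x x.2
      exact ⟨r / 2, by positivity, (Metric.closedBall_subset_ball (by linarith)).trans hsub⟩
    obtain ⟨C, hC⟩ := hL i _ (isCompact_closedBall (x : Fin Nf → ℝ) r) hrK
    have hC1 : 0 < max C 0 + 1 := by positivity
    refine ⟨min r (ε / (max C 0 + 1)), lt_min hr (div_pos hε hC1), hC.mono fun k hk y hy => ?_⟩
    have hyK : (y : Fin Nf → ℝ) ∈ Metric.closedBall (x : Fin Nf → ℝ) r := by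
      rw [Metric.mem_closedBall, dist_comm]
      exact (lt_of_lt_of_le hy (min_le_left _ _)).le
    have hxy : ‖(x : Fin Nf → ℝ) - y‖ < ε / (max C 0 + 1) := by
      rw [← dist_eq_norm]; exact lt_of_lt_of_le hy (min_le_right _ _)
    calc ‖F k i x - F k i y‖ ≤ C * ‖(x : Fin Nf → ℝ) - y‖ := hk x (Metric.mem_closedBall_self hr.le) y hyK
      _ ≤ (max C 0 + 1) * ‖(x : Fin Nf → ℝ) - y‖ :=
          mul_le_mul_of_nonneg_right ((le_max_left _ _).trans (le_add_of_nonneg_right zero_le_one)) (norm_nonneg _)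
      _ < (max C 0 + 1) * (ε / (max C 0 + 1)) := mul_lt_mul_of_pos_left hxy hC1
      _ = ε := mul_div_cancel₀ ε hC1.ne'
  obtain ⟨φ, hφ, hlim⟩ := exists_strictMono_forall_tendsto_of_equicontinuous F hbF heqF
  exact ⟨φ, hφ, fun m hm i => hlim i ⟨m, hm⟩⟩

end Summit.QuantumFields.QCD.Cruxes.ThinQCD.Registered

end
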